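import Literature.GroupTheory.CombinatorialGroupTheory.CyclicBlockInterchange
import HarnessLib

/-!
# Cyclic block interchanges change the orbit count by at most two (Heuer 2020, §3.2.3)

Sequel of `CyclicBlockInterchange.lean` (the two-circle model `α = σπ` of a letter matching,
[Heuer2020, §3.2]). [Heuer2020, §3.2.3] transports a Bardakov pairing `π` of `v + w⁻¹` through a
block interchange `γ` of `v` ("if `π` is a pairing, then `γ⁻¹πγ` is a pairing for `v + w⁻¹` after
applying the corresponding block interchange to `v`; we write `α_γ = σγ⁻¹πγ`") and computes in
Claim 3.8 that, up to conjugation by `γ`, `α_γ` is `α` followed by a permutation of the (at most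
four) cut points. This file proves the quantitative consequence used for the lower bound
`d_cbi(v,w) ≥ n/2 − max_π orb(σπ)/2` of [Heuer2020, Thm. 2 (i)]:

* parity: `orb(σπ) ≡ n (mod 2)` for every matching (`CBI.even_ncyc_alpha_add`), from
  `sign σ = 1`, `sign π = (−1)ⁿ`;
* multiplying a permutation by one moving `s ≥ 1` points changes the number of cycles by at most
  `s − 1` (`Bardakov.ncyc_le_ncyc_mul_add`, `Bardakov.ncyc_mul_le_ncyc_add`);
* the block map `γ` of a four-block interchange (`CBI.blockPerm`), the transported matching
  `p γ⁻¹`, and `γ⁻¹ α_γ γ = ρ α` with `ρ = γ⁻¹σγσ⁻¹` supported on the cut points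
  (`CBI.conj_alpha_mul_blockPerm_inv`, `CBI.card_support_rho_le`), whence
  **`orb(σπ) ≤ orb(σ π') + 2`** for the transported matching `π'` (`CBI.ncyc_alpha_le_transport`);
* along a sequence of cyclic block interchanges: **for related words there is a matching with
  `n ≤ orb(σπ) + 2 d_cbi(v,w)`** (`CBI.exists_isMatching_le_ncyc_add`), i.e.
  `d_cbi(v,w) ≥ n/2 − orb(σπ)/2` for the best pairing — one inequality of [Heuer2020, Thm. 2 (i)]
  combined with Bardakov's formula for the chain `v + w⁻¹` (loc. cit. §3.2).

Everything here is proved; no named facts.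

## References

* [Heuer2020] N. Heuer, *Computing commutator length is hard*, arXiv:2001.10230, §3.2.3
  (Lemma 3.7, Claim 3.8), §3.2.4 (Claims 3.9, 3.10, proof of Thm. 2 (i)).
-/

namespace Literature.GroupTheory.CombinatorialGroupTheory

open Equiv Equiv.Perm

/-! ### Cycle counts under multiplication by a permutation of small support -/

namespace Bardakov

variable {β : Type*} [Fintype β] [DecidableEq β]

/-- **Multiplying by a permutation moving `s` points loses at most `s − 1` cycles.** [folklore] -/
theorem ncyc_le_ncyc_mul_add (ρ f : Perm β) : ncyc f ≤ ncyc (ρ * f) + (ρ.support.card - 1) := by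
  induction h : ρ.support.card using Nat.strong_induction_on generalizing ρ with
  | _ s ih =>
    by_cases h1 : ρ = 1
    · subst h1; simp
    · obtain ⟨x, hx⟩ : ∃ x, ρ x ≠ x := by
        obtain ⟨x, hx⟩ := not_forall.1 (mt Equiv.ext h1)
        exact ⟨x, by simpa using hx⟩
      have hlt : (swap x (ρ x) * ρ).support.card < s := h ▸ card_support_swap_mul hx
      have h2 : 2 ≤ s := h ▸ two_le_card_support_of_ne_one h1
      have ih' := ih _ hlt (swap x (ρ x) * ρ) rfl
      have hρ : ρ = swap x (ρ x) * (swap x (ρ x) * ρ) := by rw [← mul_assoc, swap_mul_self, one_mul]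
      have h3 : ncyc (swap x (ρ x) * ρ * f) ≤ ncyc (ρ * f) + 1 := by
        conv_rhs => rw [hρ]
        rw [mul_assoc, mul_assoc]
        exact ncyc_le_ncyc_swap_mul_add_one _ _ _
      rw [mul_assoc] at h3
      have := ih'
      rw [mul_assoc] at this
      omega

/-- **Multiplying by a permutation moving `s` points gains at most `s − 1` cycles.** [folklore] -/
theorem ncyc_mul_le_ncyc_add (ρ f : Perm β) : ncyc (ρ * f) ≤ ncyc f + (ρ.support.card - 1) := by
  have h := ncyc_le_ncyc_mul_add ρ⁻¹ (ρ * f)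
  rw [← mul_assoc, inv_mul_cancel, one_mul, support_inv] at h
  exact h

/-- A transposition of two points on a common cycle splits it: one cycle more. [folklore] -/
theorem ncyc_swap_mul_of_sameCycle (f : Perm β) {a b : β} (hab : a ≠ b) (h : f.SameCycle a b) :
    ncyc (swap a b * f) = ncyc f + 1 := by
  set g := swap a b * f with hg
  have h1 : ncyc f ≤ ncyc g := by
    refine ncyc_le_of_sameCycle_apply fun u => ?_
    rw [hg, Perm.mul_apply]
    have hu : f.SameCycle u (f u) := (sameCycle_apply_right (f := f)).2 (SameCycle.refl f u)
    by_cases h₁ : f u = a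
    · rw [h₁, swap_apply_left]
      rw [h₁] at hu
      exact hu.trans h
    by_cases h₂ : f u = b
    · rw [h₂, swap_apply_right]
      rw [h₂] at hu
      exact hu.trans h.symm
    · rwa [swap_apply_of_ne_of_ne h₁ h₂]
  have h2 : ncyc g ≤ ncyc f + 1 := ncyc_swap_mul_le_add_one f a b
  have h3 : Perm.sign g = -Perm.sign f := by
    rw [hg, Perm.sign_mul, sign_swap hab]
    simp
  have hf := sign_eq_one_iff_even f
  have hg' := sign_eq_one_iff_even g
  rw [h3] at hg'
  rw [Nat.even_iff] at hf hg'
  rcases Int.units_eq_one_or (Perm.sign f) with h | h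
  · rw [h] at hf hg'
    have hf' : (Fintype.card β + ncyc f) % 2 = 0 := hf.1 rfl
    have hg'' : ¬ (Fintype.card β + ncyc g) % 2 = 0 := fun h' => neg_units_ne_self 1 (hg'.2 h')
    omega
  · rw [h] at hf hg'
    have hf' : ¬ (Fintype.card β + ncyc f) % 2 = 0 := fun h' => neg_units_ne_self 1 (hf.2 h')
    have hg'' : (Fintype.card β + ncyc g) % 2 = 0 := hg'.1 (neg_neg 1)
    omega

end Bardakov

namespace CBI

open Bardakov

variable {n : ℕ}

/-! ### Parity: `orb(σπ) ≡ n (mod 2)` -/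

/-- `sign σ = 1` (a rotation and its inverse). [folklore] -/
theorem sign_sigma (n : ℕ) : Perm.sign (sigma n) = 1 := by
  rw [sigma, Perm.sign_sumCongr, Perm.sign_symm, Int.units_mul_self]

/-- The pairing has no fixed points. [folklore] -/
theorem pairing_apply_ne_self (p : Perm (Fin n)) (x : Fin n ⊕ Fin n) : pairing p x ≠ x := by
  rcases x with i | j <;> simp

/-- The pairing has `n` cycles (the `n` pairs). [folklore] -/
theorem ncyc_pairing (p : Perm (Fin n)) : ncyc (pairing p) = n := by
  have h := two_mul_ncyc_eq_card_of_sq_eq_one (pairing_apply_ne_self p) (by rw [pow_two, pairing_mul_self])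
  rw [Fintype.card_sum, Fintype.card_fin] at h
  omega

/-- `sign α = sign π` (as `sign σ = 1`). [folklore] -/
theorem sign_alpha_eq (p : Perm (Fin n)) : Perm.sign (alpha p) = Perm.sign (pairing p) := by
  rw [alpha, Perm.sign_mul, sign_sigma, one_mul]

/-- **Parity of the orbit count: `orb(σπ) + n` is even** (`sign α = sign π`, and `π` has `n`
cycles on `2n` points). [cite: Heuer2020, §3.2] -/
theorem even_ncyc_alpha_add (p : Perm (Fin n)) : Even (ncyc (alpha p) + n) := by
  have h1 := sign_eq_one_iff_even (alpha p)
  have h2 := sign_eq_one_iff_even (pairing p)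
  rw [sign_alpha_eq, h2, ncyc_pairing, Fintype.card_sum, Fintype.card_fin] at h1
  rw [Nat.even_iff, Nat.even_iff] at h1
  rw [Nat.even_iff]
  omega

/-- Two matchings' orbit counts differ by an even number. [folklore] -/
theorem even_ncyc_alpha_add_ncyc_alpha (p q : Perm (Fin n)) : Even (ncyc (alpha p) + ncyc (alpha q)) := by
  have hp := even_ncyc_alpha_add p
  have hq := even_ncyc_alpha_add q
  rw [Nat.even_add] at hp hq ⊢
  tauto

/-! ### The block map of a four-block interchange `w₁ w₂ w₃ w₄ ↦ w₁ w₄ w₃ w₂` -/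

section BlockMap

variable {α : Type*}

/-- New position of the letter at old position `x` (block lengths `a, b, c, d`). [cite: Heuer2020, §3.2.3] -/
def blockFun (a b c d x : ℕ) : ℕ :=
  if x < a then x else if x < a + b then x + c + d else if x < a + b + c then x + d - b else x - (b + c)

/-- Old position of the letter at new position `y`. [cite: Heuer2020, §3.2.3] -/
def blockInv (a b c d y : ℕ) : ℕ :=
  if y < a then y else if y < a + d then y + b + c else if y < a + d + c then y + b - d else y - (c + d)

/-- The block map stays below `n`. [folklore] -/
theorem blockFun_lt {a b c d x : ℕ} (h : x < a + b + c + d) : blockFun a b c d x < a + b + c + d := by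
  unfold blockFun; split_ifs <;> omega

/-- The inverse block map stays below `n`. [folklore] -/
theorem blockInv_lt {a b c d y : ℕ} (h : y < a + b + c + d) : blockInv a b c d y < a + b + c + d := by
  unfold blockInv; split_ifs <;> omega

/-- Left inverse. [folklore] -/
theorem blockInv_blockFun {a b c d x : ℕ} (h : x < a + b + c + d) : blockInv a b c d (blockFun a b c d x) = x := by
  unfold blockFun blockInv; split_ifs <;> omega

/-- Right inverse. [folklore] -/
theorem blockFun_blockInv {a b c d y : ℕ} (h : y < a + b + c + d) : blockFun a b c d (blockInv a b c d y) = y := by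
  unfold blockFun blockInv; split_ifs <;> omega

/-- **The block map `γ`** of the interchange `w₁ w₂ w₃ w₄ ↦ w₁ w₄ w₃ w₂` (`|wᵢ| = a, b, c, d`):
old position `↦` new position. [cite: Heuer2020, §3.2.3] -/
def blockPerm (a b c d n : ℕ) (hn : n = a + b + c + d) : Perm (Fin n) where
  toFun x := ⟨blockFun a b c d x.val, by
    have h1 := x.isLt
    have h2 := @blockFun_lt a b c d x.val (by omega)
    omega⟩
  invFun y := ⟨blockInv a b c d y.val, by
    have h1 := y.isLt
    have h2 := @blockInv_lt a b c d y.val (by omega)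
    omega⟩
  left_inv x := Fin.ext (blockInv_blockFun (by have := x.isLt; omega))
  right_inv y := Fin.ext (blockFun_blockInv (by have := y.isLt; omega))

/-- Value of the block map. [folklore] -/
@[simp] theorem val_blockPerm {a b c d n : ℕ} (hn : n = a + b + c + d) (x : Fin n) :
    (blockPerm a b c d n hn x).val = blockFun a b c d x.val := rfl

/-- Off the four cut points `0, a, a+b, a+b+c` the block map commutes with the rotation
(`γσ(x) = σγ(x)` unless `x ∈ σ⁻¹{0⁺, i₁⁺, i₂⁺, i₃⁺}`, [Heuer2020, proof of Claim 3.8]). [cite: Heuer2020, Claim 3.8] -/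
theorem blockPerm_finRotate {a b c d n : ℕ} (hn : n = a + b + c + d) (y : Fin n)
    (h0 : (finRotate n y).val ≠ 0) (h1 : (finRotate n y).val ≠ a) (h2 : (finRotate n y).val ≠ a + b)
    (h3 : (finRotate n y).val ≠ a + b + c) :
    blockPerm a b c d n hn (finRotate n y) = finRotate n (blockPerm a b c d n hn y) := by
  apply Fin.ext
  have hy := y.isLt
  have e1 : ((finRotate n) y).val = if y.val + 1 = n then 0 else y.val + 1 := Bardakov.val_finRotate y
  have e2 : ((finRotate n) (blockPerm a b c d n hn y)).val =
      if blockFun a b c d y.val + 1 = n then 0 else blockFun a b c d y.val + 1 := Bardakov.val_finRotate _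
  rw [val_blockPerm, e1, e2]
  rw [e1] at h0 h1 h2 h3
  have hb := blockFun_lt (a := a) (b := b) (c := c) (d := d) (x := y.val) (by omega)
  by_cases hy1 : y.val + 1 = n
  · rw [if_pos hy1] at h0; exact absurd rfl h0
  · rw [if_neg hy1] at h1 h2 h3 ⊢
    unfold blockFun at hb ⊢
    split_ifs at hb ⊢ <;> omega

/-- Letters in the four blocks of `w₁ ++ w₂ ++ w₃ ++ w₄`. [folklore] -/
theorem getElem_append4 (w₁ w₂ w₃ w₄ : List α) (x : ℕ) (hx : x < (w₁ ++ w₂ ++ w₃ ++ w₄).length) :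
    (w₁ ++ w₂ ++ w₃ ++ w₄)[x] =
      if h₁ : x < w₁.length then w₁[x]
      else if h₂ : x < w₁.length + w₂.length then w₂[x - w₁.length]'(by omega)
      else if h₃ : x < w₁.length + w₂.length + w₃.length then w₃[x - (w₁.length + w₂.length)]'(by omega)
      else w₄[x - (w₁.length + w₂.length + w₃.length)]'(by simp at hx; omega) := by
  simp only [List.length_append] at hx
  split_ifs with h₁ h₂ h₃
  · rw [List.getElem_append_left (by simp; omega), List.getElem_append_left (by simp; omega),
      List.getElem_append_left h₁]
  · rw [List.getElem_append_left (by simp; omega), List.getElem_append_left (by simp; omega),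
      List.getElem_append_right (by omega)]
  · rw [List.getElem_append_left (by simp; omega), List.getElem_append_right (by simp; omega)]
    simp only [List.length_append]
  · rw [List.getElem_append_right (by simp; omega)]
    simp only [List.length_append]

/-- **The block map moves letters correctly**: the letter at new position `γ x` of
`w₁ w₄ w₃ w₂` is the letter at old position `x` of `w₁ w₂ w₃ w₄`. [cite: Heuer2020, §3.2.3] -/
theorem getElem_interchange_blockFun {a b c d : ℕ} (w₁ w₂ w₃ w₄ : List α) (h₁ : w₁.length = a)
    (h₂ : w₂.length = b) (h₃ : w₃.length = c) (h₄ : w₄.length = d) (x : ℕ)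
    (hx : x < (w₁ ++ w₂ ++ w₃ ++ w₄).length) (hy : blockFun a b c d x < (w₁ ++ w₄ ++ w₃ ++ w₂).length) :
    (w₁ ++ w₄ ++ w₃ ++ w₂)[blockFun a b c d x] = (w₁ ++ w₂ ++ w₃ ++ w₄)[x] := by
  subst h₁ h₂ h₃ h₄
  rw [getElem_append4, getElem_append4]
  simp only [List.length_append] at hx hy
  unfold blockFun at hy ⊢
  by_cases c1 : x < w₁.length
  · simp [c1]
  by_cases c2 : x < w₁.length + w₂.length
  · simp only [c1, c2, if_false, if_true, dif_neg, dif_pos, not_false_eq_true]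
    rw [dif_neg (by omega), dif_neg (by omega), dif_neg (by omega)]
    congr 1; omega
  by_cases c3 : x < w₁.length + w₂.length + w₃.length
  · simp only [c1, c2, c3, if_false, if_true, dif_neg, dif_pos, not_false_eq_true]
    rw [dif_neg (by omega), dif_neg (by omega), dif_pos (by omega)]
    congr 1; omega
  · simp only [c1, c2, c3, if_false, dif_neg, not_false_eq_true]
    rw [dif_neg (by omega), dif_pos (by omega)]
    congr 1; omega

end BlockMap

/-! ### Transport of a matching through a position permutation: `γ⁻¹ α_γ γ = ρ α` -/

section Transport

/-- `Γ`: the position permutation `γ` on the `v`-circle, the identity on the `w`-circle. [cite: Heuer2020, §3.2.3] -/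
def Gam (γ : Perm (Fin n)) : Perm (Fin n ⊕ Fin n) := Perm.sumCongr γ 1

/-- `ρ = Γ⁻¹ σ Γ σ⁻¹`, the correction permutation of [Heuer2020, Claim 3.8]. [cite: Heuer2020, Claim 3.8] -/
def rho (γ : Perm (Fin n)) : Perm (Fin n ⊕ Fin n) := (Gam γ)⁻¹ * sigma n * Gam γ * (sigma n)⁻¹

/-- `Γ` on `I⁺`. [folklore] -/
@[simp] theorem Gam_inl (γ : Perm (Fin n)) (i : Fin n) : Gam γ (Sum.inl i) = Sum.inl (γ i) := rfl
/-- `Γ` on `I⁻`. [folklore] -/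
@[simp] theorem Gam_inr (γ : Perm (Fin n)) (j : Fin n) : Gam γ (Sum.inr j) = Sum.inr j := rfl
/-- `Γ⁻¹` on `I⁺`. [folklore] -/
@[simp] theorem Gam_inv_inl (γ : Perm (Fin n)) (i : Fin n) : (Gam γ)⁻¹ (Sum.inl i) = Sum.inl (γ⁻¹ i) := rfl
/-- `Γ⁻¹` on `I⁻`. [folklore] -/
@[simp] theorem Gam_inv_inr (γ : Perm (Fin n)) (j : Fin n) : (Gam γ)⁻¹ (Sum.inr j) = Sum.inr j := rfl
/-- `σ⁻¹` on `I⁺`. [folklore] -/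
@[simp] theorem sigma_inv_inl (i : Fin n) : (sigma n)⁻¹ (Sum.inl i) = Sum.inl ((finRotate n).symm i) := rfl
/-- `σ⁻¹` on `I⁻`. [folklore] -/
@[simp] theorem sigma_inv_inr (j : Fin n) : (sigma n)⁻¹ (Sum.inr j) = Sum.inr (finRotate n j) := rfl

/-- `ρ` on the `v`-circle. [cite: Heuer2020, Claim 3.8] -/
theorem rho_inl (γ : Perm (Fin n)) (x : Fin n) :
    rho γ (Sum.inl x) = Sum.inl (γ⁻¹ (finRotate n (γ ((finRotate n).symm x)))) := rfl

/-- `ρ` is the identity on the `w`-circle. [cite: Heuer2020, Claim 3.8] -/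
@[simp] theorem rho_inr (γ : Perm (Fin n)) (j : Fin n) : rho γ (Sum.inr j) = Sum.inr j := by
  rw [show rho γ (Sum.inr j) = Sum.inr ((finRotate n).symm (finRotate n j)) from rfl, Equiv.symm_apply_apply]

/-- `ρ` fixes `x⁺` when `γ` commutes with the rotation at `σ⁻¹ x`. [cite: Heuer2020, Claim 3.8] -/
theorem rho_inl_of_comm (γ : Perm (Fin n)) {x : Fin n}
    (h : γ (finRotate n ((finRotate n).symm x)) = finRotate n (γ ((finRotate n).symm x))) :
    rho γ (Sum.inl x) = Sum.inl x := by
  rw [rho_inl, ← h, Equiv.apply_symm_apply, Perm.inv_def, Equiv.symm_apply_apply]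

/-- **The transported matching**: if `p` matches `V` against `W` and `U (γ x) = V x`, then `p γ⁻¹`
matches `U` against `W` ("`γ⁻¹πγ` is a pairing for `v + w⁻¹` after applying the block
interchange to `v`"). [cite: Heuer2020, §3.2.3] -/
theorem IsMatching.transport {α : Type*} {V U W : Fin n → α} {p : Perm (Fin n)} (hp : IsMatching V W p)
    (γ : Perm (Fin n)) (hU : ∀ x, U (γ x) = V x) : IsMatching U W (p * γ⁻¹) := by
  intro y
  rw [Perm.mul_apply, hp, ← hU, Perm.inv_def, Equiv.apply_symm_apply]

/-- **Claim 3.8 in conjugated form: `Γ⁻¹ α_{γ} Γ = ρ α`** with `α_γ = alpha (p γ⁻¹)`. [cite: Heuer2020, Claim 3.8] -/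
theorem conj_alpha_transport (p γ : Perm (Fin n)) :
    (Gam γ)⁻¹ * alpha (p * γ⁻¹) * Gam γ = rho γ * alpha p := by
  refine Equiv.ext fun z => ?_
  rcases z with i | j
  · simp only [Perm.mul_apply, Gam_inl, alpha_inl, Gam_inv_inr, rho_inr]
    rw [Perm.inv_def, Equiv.symm_apply_apply]
  · simp only [Perm.mul_apply, Gam_inr, alpha_inr, Gam_inv_inl]
    rw [rho_inl, Equiv.symm_apply_apply, Perm.mul_def, Equiv.symm_trans_apply, Perm.inv_def, Equiv.symm_symm]

/-- Hence `orb(α_γ) = orb(ρ α)`. [cite: Heuer2020, Lemma 3.7] -/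
theorem ncyc_alpha_transport (p γ : Perm (Fin n)) : ncyc (alpha (p * γ⁻¹)) = ncyc (rho γ * alpha p) := by
  rw [← conj_alpha_transport, show (Gam γ)⁻¹ * alpha (p * γ⁻¹) * Gam γ =
    (Gam γ)⁻¹ * alpha (p * γ⁻¹) * ((Gam γ)⁻¹)⁻¹ by rw [inv_inv], ncyc_conj]

/-- The support of `ρ` lies over the points where `γ` fails to commute with the rotation. [cite: Heuer2020, Claim 3.8] -/
theorem support_rho_subset (γ : Perm (Fin n)) :
    (rho γ).support ⊆ (Finset.univ.filter fun x : Fin n =>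
      γ (finRotate n ((finRotate n).symm x)) ≠ finRotate n (γ ((finRotate n).symm x))).map
        ⟨Sum.inl, Sum.inl_injective⟩ := by
  intro z hz
  rw [Perm.mem_support] at hz
  rcases z with x | j
  · rw [Finset.mem_map]
    refine ⟨x, ?_, rfl⟩
    rw [Finset.mem_filter]
    exact ⟨Finset.mem_univ _, fun h => hz (rho_inl_of_comm γ h)⟩
  · exact absurd (rho_inr γ j) hz

/-- **Transport costs at most two orbits** when `γ` commutes with the rotation off a set of at
most four points (the cut points of a block interchange): `orb(σπ) ≤ orb(σπ') + 2` for the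
transported matching `π' = p γ⁻¹` — `ρ` then moves at most four points, so multiplying by it
changes the number of cycles by at most three, and by parity by at most two. [cite: Heuer2020, Lemma 3.7] -/
theorem ncyc_alpha_le_transport (p γ : Perm (Fin n))
    (h4 : (Finset.univ.filter fun x : Fin n =>
      γ (finRotate n ((finRotate n).symm x)) ≠ finRotate n (γ ((finRotate n).symm x))).card ≤ 4) :
    ncyc (alpha p) ≤ ncyc (alpha (p * γ⁻¹)) + 2 := by
  have h1 := ncyc_le_ncyc_mul_add (rho γ) (alpha p)
  have h2 : (rho γ).support.card ≤ 4 :=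
    (Finset.card_le_card (support_rho_subset γ)).trans (by rwa [Finset.card_map])
  have h3 := even_ncyc_alpha_add_ncyc_alpha p (p * γ⁻¹)
  rw [ncyc_alpha_transport]
  rw [ncyc_alpha_transport, Nat.even_iff] at h3
  omega

/-- The same bound in the other direction. [cite: Heuer2020, Lemma 3.7] -/
theorem ncyc_alpha_transport_le (p γ : Perm (Fin n))
    (h4 : (Finset.univ.filter fun x : Fin n =>
      γ (finRotate n ((finRotate n).symm x)) ≠ finRotate n (γ ((finRotate n).symm x))).card ≤ 4) :
    ncyc (alpha (p * γ⁻¹)) ≤ ncyc (alpha p) + 2 := by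
  have h1 := ncyc_mul_le_ncyc_add (rho γ) (alpha p)
  have h2 : (rho γ).support.card ≤ 4 :=
    (Finset.card_le_card (support_rho_subset γ)).trans (by rwa [Finset.card_map])
  have h3 := even_ncyc_alpha_add_ncyc_alpha p (p * γ⁻¹)
  rw [ncyc_alpha_transport]
  rw [ncyc_alpha_transport, Nat.even_iff] at h3
  omega

/-- **The block map has at most four cut points.** [cite: Heuer2020, Claim 3.8] -/
theorem card_cut_blockPerm_le {a b c d : ℕ} (hn : n = a + b + c + d) :
    (Finset.univ.filter fun x : Fin n =>
      blockPerm a b c d n hn (finRotate n ((finRotate n).symm x)) ≠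
        finRotate n (blockPerm a b c d n hn ((finRotate n).symm x))).card ≤ 4 := by
  have hsub : (Finset.univ.filter fun x : Fin n =>
      blockPerm a b c d n hn (finRotate n ((finRotate n).symm x)) ≠
        finRotate n (blockPerm a b c d n hn ((finRotate n).symm x))) ⊆
      Finset.univ.filter fun x : Fin n => x.val = 0 ∨ x.val = a ∨ x.val = a + b ∨ x.val = a + b + c := by
    intro x hx
    rw [Finset.mem_filter] at hx ⊢
    refine ⟨Finset.mem_univ _, ?_⟩
    by_contra hne
    push Not at hne
    refine hx.2 (blockPerm_finRotate hn _ ?_ ?_ ?_ ?_) <;> rw [Equiv.apply_symm_apply]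
    · exact hne.1
    · exact hne.2.1
    · exact hne.2.2.1
    · exact hne.2.2.2
  refine (Finset.card_le_card hsub).trans ?_
  have hinj : Set.InjOn (fun x : Fin n => x.val)
      ↑(Finset.univ.filter fun x : Fin n => x.val = 0 ∨ x.val = a ∨ x.val = a + b ∨ x.val = a + b + c) :=
    fun x _ y _ h => Fin.ext h
  have hmaps : ∀ x ∈ (Finset.univ.filter fun x : Fin n => x.val = 0 ∨ x.val = a ∨ x.val = a + b ∨ x.val = a + b + c),
      (fun x : Fin n => x.val) x ∈ ({0, a, a + b, a + b + c} : Finset ℕ) := by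
    intro x hx
    rw [Finset.mem_filter] at hx
    simp only [Finset.mem_insert, Finset.mem_singleton]
    exact hx.2
  refine (Finset.card_le_card_of_injOn _ hmaps hinj).trans ?_
  exact (Finset.card_insert_le _ _).trans (Nat.succ_le_succ ((Finset.card_insert_le _ _).trans
    (Nat.succ_le_succ ((Finset.card_insert_le _ _).trans (Nat.succ_le_succ (Finset.card_singleton _).le)))))

end Transport

/-! ### Transport along cyclic block interchanges of words -/

section Chain

variable {α : Type*}

/-- `ρ = 1` when `γ` commutes with the rotation everywhere (e.g. `γ` a rotation). [folklore] -/
theorem rho_eq_one_of_comm {γ : Perm (Fin n)} (h : ∀ y, γ (finRotate n y) = finRotate n (γ y)) : rho γ = 1 := by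
  refine Equiv.ext fun z => ?_
  rcases z with x | j
  · rw [Perm.one_apply]
    exact rho_inl_of_comm γ (h _)
  · rw [Perm.one_apply, rho_inr]

/-- Transport through a permutation commuting with the rotation does not change the orbit count. [folklore] -/
theorem ncyc_alpha_transport_of_comm (p : Perm (Fin n)) {γ : Perm (Fin n)}
    (h : ∀ y, γ (finRotate n y) = finRotate n (γ y)) : ncyc (alpha (p * γ⁻¹)) = ncyc (alpha p) := by
  rw [ncyc_alpha_transport, rho_eq_one_of_comm h, one_mul]

/-- Powers of the rotation commute with the rotation. [folklore] -/
theorem pow_finRotate_comm (k : ℕ) (y : Fin n) :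
    ((finRotate n) ^ k) (finRotate n y) = finRotate n (((finRotate n) ^ k) y) := by
  rw [← Perm.mul_apply, ← Perm.mul_apply, (Commute.self_pow (finRotate n) k).eq]

/-- Inverse powers of the rotation commute with the rotation. [folklore] -/
theorem pow_finRotate_inv_comm (k : ℕ) (y : Fin n) :
    ((finRotate n) ^ k)⁻¹ (finRotate n y) = finRotate n (((finRotate n) ^ k)⁻¹ y) := by
  rw [← Perm.mul_apply, ← Perm.mul_apply, ((Commute.self_pow (finRotate n) k).inv_right).eq]

/-- A list of length `n` is an `ofFn`. [folklore] -/
theorem exists_eq_ofFn {u : List α} (h : u.length = n) : ∃ U : Fin n → α, u = List.ofFn U := by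
  subst h
  exact ⟨fun i => u[i.val], List.ofFn_getElem.symm⟩

/-- Rotating the `v`-word: a matching of `V' ∘ σᵏ` against `W` gives one of `V'`, same orbit count. [folklore] -/
theorem exists_isMatching_of_rotate {V V' W : Fin n → α} {k : ℕ} (hV : V = V' ∘ ((finRotate n) ^ k))
    {p : Perm (Fin n)} (hp : IsMatching V W p) : ∃ q, IsMatching V' W q ∧ ncyc (alpha q) = ncyc (alpha p) :=
  ⟨p * ((finRotate n) ^ k)⁻¹, hp.transport _ fun x => by rw [hV, Function.comp_apply],
    ncyc_alpha_transport_of_comm p (pow_finRotate_comm k)⟩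

/-- Un-rotating the `v`-word: a matching of `V'` against `W` gives one of `V' ∘ σᵏ`, same orbit count. [folklore] -/
theorem exists_isMatching_of_rotate' {V V' W : Fin n → α} {k : ℕ} (hV : V = V' ∘ ((finRotate n) ^ k))
    {p : Perm (Fin n)} (hp : IsMatching V' W p) : ∃ q, IsMatching V W q ∧ ncyc (alpha q) = ncyc (alpha p) := by
  refine ⟨p * (((finRotate n) ^ k)⁻¹)⁻¹, hp.transport _ fun x => ?_,
    ncyc_alpha_transport_of_comm p (pow_finRotate_inv_comm k)⟩
  rw [hV, Function.comp_apply, Perm.inv_def, Equiv.apply_symm_apply]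

/-- A cyclic permutation of an `ofFn` word is the `ofFn` of a rotated function. [folklore] -/
theorem exists_comp_pow_of_isRotated {V : Fin n → α} {v' : List α} (h : v' ~r List.ofFn V) :
    ∃ (V' : Fin n → α) (k : ℕ), v' = List.ofFn V' ∧ V = V' ∘ ((finRotate n) ^ k) := by
  obtain ⟨k, hk⟩ := h
  have hlen : v'.length = n := by rw [← List.length_rotate v' k, hk, List.length_ofFn]
  obtain ⟨V', rfl⟩ := exists_eq_ofFn hlen
  refine ⟨V', k, rfl, ?_⟩
  rw [← ofFn_comp_finRotate_pow', List.ofFn_inj] at hk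
  exact hk.symm

/-- **The transported matching of a block interchange of words**, for prescribed block lengths. [cite: Heuer2020, §3.2.3] -/
theorem IsMatching.transport_blockPerm {n a b c d : ℕ} (hn : n = a + b + c + d) {V U W : Fin n → α}
    {w₁ w₂ w₃ w₄ : List α} (h₁ : w₁.length = a) (h₂ : w₂.length = b) (h₃ : w₃.length = c) (h₄ : w₄.length = d)
    (hv : List.ofFn V = w₁ ++ w₂ ++ w₃ ++ w₄) (hu : List.ofFn U = w₁ ++ w₄ ++ w₃ ++ w₂)
    {p : Perm (Fin n)} (hp : IsMatching V W p) :
    IsMatching U W (p * (blockPerm a b c d n hn)⁻¹) := by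
  refine hp.transport _ fun x => ?_
  have hV : V x = (List.ofFn V)[x.val]'(by rw [List.length_ofFn]; exact x.isLt) := by
    rw [List.getElem_ofFn]
  have hU : U (blockPerm a b c d n hn x) =
      (List.ofFn U)[(blockPerm a b c d n hn x).val]'(by
        rw [List.length_ofFn]; exact (blockPerm a b c d n hn x).isLt) := by
    rw [List.getElem_ofFn]
  rw [hV, hU, List.getElem_of_eq hu, List.getElem_of_eq hv]
  exact getElem_interchange_blockFun w₁ w₂ w₃ w₄ h₁ h₂ h₃ h₄ x.val (by simp only [List.length_append]; omega)
    (by have := @blockFun_lt a b c d x.val (by omega)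
        simp only [List.length_append]; omega)

/-- **Transport through a block interchange of words costs at most two orbits.** [cite: Heuer2020, Lemma 3.7] -/
theorem exists_isMatching_of_isBlockInterchange {V U W : Fin n → α}
    (h : IsBlockInterchange (List.ofFn V) (List.ofFn U)) {p : Perm (Fin n)} (hp : IsMatching V W p) :
    ∃ q, IsMatching U W q ∧ ncyc (alpha p) ≤ ncyc (alpha q) + 2 := by
  obtain ⟨w₁, w₂, w₃, w₄, hv, hu⟩ := h
  have hn : n = w₁.length + w₂.length + w₃.length + w₄.length := by
    have := congrArg List.length hv
    simp only [List.length_ofFn, List.length_append] at this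
    omega
  exact ⟨_, hp.transport_blockPerm hn rfl rfl rfl rfl hv hu, ncyc_alpha_le_transport p _ (card_cut_blockPerm_le hn)⟩

/-- **Transport through a cyclic block interchange of words costs at most two orbits.** [cite: Heuer2020, Lemma 3.7] -/
theorem exists_isMatching_of_isCBI {V U W : Fin n → α} (h : IsCBI (List.ofFn V) (List.ofFn U))
    {p : Perm (Fin n)} (hp : IsMatching V W p) : ∃ q, IsMatching U W q ∧ ncyc (alpha p) ≤ ncyc (alpha q) + 2 := by
  obtain ⟨v', u', hv', hu', hbi⟩ := h
  obtain ⟨V', k₁, rfl, hV⟩ := exists_comp_pow_of_isRotated hv'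
  obtain ⟨U', k₂, rfl, hU⟩ := exists_comp_pow_of_isRotated hu'
  obtain ⟨p₁, hp₁, hc₁⟩ := exists_isMatching_of_rotate hV hp
  obtain ⟨p₂, hp₂, hc₂⟩ := exists_isMatching_of_isBlockInterchange hbi hp₁
  obtain ⟨p₃, hp₃, hc₃⟩ := exists_isMatching_of_rotate' hU hp₂
  exact ⟨p₃, hp₃, by omega⟩

/-- **Along a sequence of `k` cyclic block interchanges**: a matching with `n ≤ orb(σπ) + 2k`. [cite: Heuer2020, Thm. 2 (i)] -/
theorem exists_isMatching_of_reach {W : Fin n → α} :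
    ∀ {k : ℕ} {V : Fin n → α}, Reach k (List.ofFn V) (List.ofFn W) →
      ∃ p, IsMatching V W p ∧ n ≤ ncyc (alpha p) + 2 * k
  | 0, V, h => by
    obtain ⟨p, hp, hc⟩ := (exists_isMatching_ncyc_eq_iff V W).2 (reach_zero.1 h).symm
    exact ⟨p, hp, by omega⟩
  | k + 1, V, h => by
    obtain ⟨u, hVu, hu⟩ := h
    have hlen : u.length = n := by rw [← hVu.length_eq, List.length_ofFn]
    obtain ⟨U, rfl⟩ := exists_eq_ofFn hlen
    obtain ⟨q, hq, hcq⟩ := exists_isMatching_of_reach hu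
    obtain ⟨p, hp, hcp⟩ := exists_isMatching_of_isCBI hVu.symm hq
    exact ⟨p, hp, by omega⟩

/-- **`d_cbi(v,w) ≥ n/2 − max_π orb(σπ)/2`**: for related words there is a matching with
`n ≤ orb(σπ) + 2 d_cbi(v, w)` — the lower bound for the cyclic block interchange distance in
[Heuer2020, Thm. 2 (i)] (there phrased through Bardakov's `cl(v + w⁻¹) = min_π (n − orb(σπ))/2`
and Claim 3.10). [cite: Heuer2020, Thm. 2 (i)] -/
theorem exists_isMatching_le_ncyc_add {V W : Fin n → α} (h : List.Perm (List.ofFn V) (List.ofFn W)) :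
    ∃ p, IsMatching V W p ∧ n ≤ ncyc (alpha p) + 2 * dcbi (List.ofFn V) (List.ofFn W) :=
  exists_isMatching_of_reach (reach_dcbi h)

end Chain

end CBI

end Literature.GroupTheory.CombinatorialGroupTheory
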